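import Literature.Probability.Percolation.MarkedLoopHolomorphy
import HarnessLib

/-!
# The exact holomorphic defect of a class-weighted `k`-disorder observable («TRIPOD-DEFECT», every number of marks)

Topic `Literature/Probability/Percolation`; generic-`k` layer of the three-disorder lineage (Khristoforov–Smirnov 2021), a sequel of
`MarkedLoopHolomorphy.lean` (HOLO-K). HOLO-K proves the IMPLICATION «tripod law ⇒ discrete holomorphicity» (`holomorphicW_of_tripodLaw`):
a class weight `wt j L` (partner `j`, link relation `L`) whose TRIPOD DEFECT
`wt α (L₀+βγ) + τ·wt β (L₀+γα) + τ²·wt γ (L₀+αβ)` vanishes on every tripod picture `(α, β, γ; L₀)` gives an observable with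
`Σ_{i : Fin 3} τ^i ObsW wt v i = 0` at every face `v` with three `H_G`-sides. This file records the EXACT IDENTITY behind it, for an
ARBITRARY class weight (no law assumed):

* `tripodDefect wt α β γ L₀` — the defect; `tripodLaw_iff_tripodDefect`; ★ `tripodDefect_rotate` — the reading from the next corner is `τ²`
  times the defect (the three anticlockwise readings of one picture vanish together).
* ★ `coreTerm_eq_zero_of_not_relinking` — an INVARIANT core (one odd neighbour, or two linked odd neighbours) contributes
  `(1 + τ + τ²)·w = 0` to `Σ_i τ^i ObsW` for EVERY weight; ★ `coreTerm_eq_tripodDefect` — a RE-LINKING core (three odd, pairwise unlinked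
  neighbours with corner partners `p 0, p 1, p 2`) contributes exactly `tripodDefect wt (p 0) (p 1) (p 2) (linkRel ζ)`.
* ★★ `sum_tau_obsW_eq_sum_pictureCount` — **the holomorphic defect is a non-negative integer combination of tripod defects**:
  `Σ_i τ^i ObsW D wt v i = Σ_P  #{re-linking cores at v with picture P} · tripodDefect wt P`, the sum over all
  `P = (α, β, γ, L₀)`; and `tripodPicture_of_pictureCount_ne_zero` — only TRIPOD PICTURES occur (HOLO-K's `tripodPicture_of_core`).
* ★★ THREE DISORDERS, CLOSED FORM (`§ Three`): at `k = 3` every tripod picture is a rotation of `(0, 1, 2; ∅)` (`tripodPicture_three`), the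
  three readings have defects `Δ, τ²Δ, τ⁴Δ` with `Δ(wt) = wt 0 (12) + τ·wt 1 (20) + τ²·wt 2 (01)` (`tripodDefect_three`), hence
  `Σ_i τ^i ObsW D wt v i = N_D(v) · Δ(wt)` (`sum_tau_obsW_three`) with the RE-LINKING INDEX `N_D(v) = Σ_d τ^{2d} #{re-linking cores at v with
  first partner y_d}` (`relinkIndex`); so a three-disorder class weight is holomorphic on `D` iff it obeys Khristoforov–Smirnov's relation or
  `N_D ≡ 0` on `D` (`holomorphicW_three_iff`), and `N_D(v)` is one third of the contour sum of the conjugate weight `τ̄^j` (`sum_tau_obsW_conj_three`).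
* Consequences: `sum_tau_obsW_eq_of_tripodDefect_eq` (two weights with the same defects on tripod pictures have the same holomorphic
  defect at every face of every domain), `holomorphicW_iff_sum_pictureCount` (holomorphicity of `wt` on `D` is the finite linear system
  `Σ_P c_P(v)·defect_P(wt) = 0`, `v` ranging over the faces of `D`), and HOLO-K's theorem again (`holomorphicW_of_tripodLaw'`, one line).

The identity is the bookkeeping of Khristoforov–Smirnov's proof of Lemma 4 (§2 p. 4 and Fig. 3: «each triple contributes zero») with
the conclusion read off BEFORE the tripod relation is used; it is the lane's tool for the converse direction (which pictures are forced
by holomorphicity on a given family of domains = the column space of the matrix `(c_P(v))`), not a published statement.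

## References
* M. Khristoforov, S. Smirnov, *Percolation and O(1) loop model*, arXiv:2111.15612 (2021), §1.2 (arXiv v1 p. 2: loop configurations
  with `k` disorders, link patterns), §2 Definition 3, Lemma 4 with its proof and Fig. 3 (p. 4).
* B. Bollobás, O. Riordan, *Percolation*, Cambridge University Press (2006), Ch. 7 §7.2.2 (pp. 191–195: marked discrete domains).

## Mathlib / tree
Tree: `MarkedLoopHolomorphy.lean` (`TripodLaw`, `TripodPicture`, `HolomorphicW`, `ObsW`, `GkW`, `linkRel`, `withPair`, `gkW_compl_eq`,
`linkRel_coreCompl_of_inv`, `linkRel_coreCompl_relink`, `eq_partner_of_linked`, `tripodPicture_of_core`), `KhSThreeDisorderObservable.lean`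
(`AllSides`, `IsCoreb`, `coreSetb`, `ComplClassX`, `hbK_regroup`, `hbK_compl_mem`, `hbK_complClass_existsUnique`, `invariantTriplesX_holds`,
`hbK_core_partners`, `hbK_inClassX_iff`), `FivePointHolomorphyFaces.lean` (`coreCompl`, `coreEnd`). Mathlib: `Finset.sum_comm`,
`Finset.sum_ite_eq'`, `Finset.sum_boole`, `IsPrimitiveRoot.geom_sum_eq_zero`.
-/

open Finset

namespace Literature.Probability.Percolation.MarkedLoops

open Literature.Probability.Percolation Literature.Probability.LatticeModels
open Literature.Probability.Percolation.FivePoint (xiDeg XiLinked tau)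
open Literature.Probability.Percolation.FivePoint.N5 (sideGraph xiLinked_iff_reachable coreCompl coreEnd)
open TriMarkedDomain

/-! ### The tripod defect -/
section Defect

variable {nm : ℕ}

/-- `τ² + τ + 1 = 0`. [folklore] -/
private theorem tau_sum'' : 1 + tau + tau ^ 2 = 0 := by
  have hprim : IsPrimitiveRoot tau 3 := by
    have h := Complex.isPrimitiveRoot_exp 3 (by norm_num)
    unfold tau
    convert h using 2
    push_cast
    ring
  have h := hprim.geom_sum_eq_zero (by norm_num : 1 < 3)
  simp only [Finset.sum_range_succ, Finset.sum_range_zero, pow_zero, pow_one, zero_add] at h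
  linear_combination h

/-- `τ³ = 1`. [folklore] -/
private theorem tau_cube'' : tau ^ 3 = 1 := by linear_combination (tau - 1) * tau_sum''

/-- **the TRIPOD DEFECT** of a class weight `wt` at `(α, β, γ; L₀)`: `wt α (L₀+βγ) + τ·wt β (L₀+γα) + τ²·wt γ (L₀+αβ)` — the left-hand
side of the tripod law. [cite: KhristoforovSmirnov2021, §2 Lemma 4, proof and Fig. 3 (p. 4: «each triple contributes zero»)] -/
noncomputable def tripodDefect (wt : Fin nm → Finset (Fin nm × Fin nm) → ℂ) (α β γ : Fin nm) (L₀ : Finset (Fin nm × Fin nm)) : ℂ :=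
  wt α (withPair L₀ β γ) + tau * wt β (withPair L₀ γ α) + tau ^ 2 * wt γ (withPair L₀ α β)

/-- the tripod law says: the defect vanishes on every tripod picture. [cite: KhristoforovSmirnov2021, §2 Lemma 4, proof and Fig. 3 (p. 4)] -/
theorem tripodLaw_iff_tripodDefect (wt : Fin nm → Finset (Fin nm × Fin nm) → ℂ) :
    TripodLaw wt ↔ ∀ (α β γ : Fin nm) (L₀ : Finset (Fin nm × Fin nm)), TripodPicture α β γ L₀ → tripodDefect wt α β γ L₀ = 0 := by
  unfold TripodLaw tripodDefect
  exact Iff.rfl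

/-- the defect is additive in the weight. [cite: KhristoforovSmirnov2021, §2 Lemma 4 (p. 4)] -/
theorem tripodDefect_add (wt wt' : Fin nm → Finset (Fin nm × Fin nm) → ℂ) (α β γ : Fin nm) (L₀ : Finset (Fin nm × Fin nm)) :
    tripodDefect (wt + wt') α β γ L₀ = tripodDefect wt α β γ L₀ + tripodDefect wt' α β γ L₀ := by
  unfold tripodDefect
  simp only [Pi.add_apply]
  ring

/-- the defect is homogeneous in the weight. [cite: KhristoforovSmirnov2021, §2 Lemma 4 (p. 4)] -/
theorem tripodDefect_smul (c : ℂ) (wt : Fin nm → Finset (Fin nm × Fin nm) → ℂ) (α β γ : Fin nm) (L₀ : Finset (Fin nm × Fin nm)) :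
    tripodDefect (c • wt) α β γ L₀ = c * tripodDefect wt α β γ L₀ := by
  unfold tripodDefect
  simp only [Pi.smul_apply, smul_eq_mul]
  ring

/-- the zero weight has no defect. [cite: KhristoforovSmirnov2021, §2 Lemma 4 (p. 4)] -/
theorem tripodDefect_zero (α β γ : Fin nm) (L₀ : Finset (Fin nm × Fin nm)) :
    tripodDefect (fun (_ : Fin nm) (_ : Finset (Fin nm × Fin nm)) => (0 : ℂ)) α β γ L₀ = 0 := by
  unfold tripodDefect
  ring

/-- ★ reading a picture from its NEXT corner multiplies the defect by `τ²` (so the three readings `(α, β, γ)`, `(β, γ, α)`, `(γ, α, β)` of one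
tripod picture — all anticlockwise — carry proportional defects `d, τ² d, τ d`; at a face the side labelling `i ↦ oppFace v i` is anticlockwise up
to exactly this rotation). [cite: KhristoforovSmirnov2021, §2 Lemma 4, proof and Fig. 3 (p. 4); §2 Definition 3 (p. 4: `u₁, u₂, u₃` counterclockwise)] -/
theorem tripodDefect_rotate (wt : Fin nm → Finset (Fin nm × Fin nm) → ℂ) (α β γ : Fin nm) (L₀ : Finset (Fin nm × Fin nm)) :
    tripodDefect wt β γ α L₀ = tau ^ 2 * tripodDefect wt α β γ L₀ := by
  unfold tripodDefect
  linear_combination (-(wt β (withPair L₀ γ α)) - tau * wt γ (withPair L₀ α β)) * tau_cube''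

/-- the three readings of a picture have defects vanishing together. [cite: KhristoforovSmirnov2021, §2 Lemma 4, proof and Fig. 3 (p. 4)] -/
theorem tripodDefect_rotate_eq_zero_iff (wt : Fin nm → Finset (Fin nm × Fin nm) → ℂ) (α β γ : Fin nm) (L₀ : Finset (Fin nm × Fin nm)) :
    tripodDefect wt β γ α L₀ = 0 ↔ tripodDefect wt α β γ L₀ = 0 := by
  rw [tripodDefect_rotate, mul_eq_zero, or_iff_right]
  exact pow_ne_zero 2 (fun h => by have := tau_cube''; rw [h] at this; norm_num at this)

end Defect

/-! ### Core by core -/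
section Cores

variable {nm : ℕ} {D : TriMarkedDomain nm}

/-- a **RE-LINKING core** at `v`: all three neighbours of `v` are odd-indexed (`S = univ`) and no two of them are linked in the core.
[cite: KhristoforovSmirnov2021, §2 Lemma 4, proof and Fig. 3 (p. 4: the triples whose three completions have different link patterns)] -/
def IsRelinking (v : HexVertex) (q : Finset (Fin 3) × Finset (Sym2 (Site 2))) : Prop :=
  q.1 = Finset.univ ∧ ∀ i i' : Fin 3, i ≠ i' → ¬ XiLinked q.2 (oppFace v i) (oppFace v i')

/-- a core that is not re-linking is INVARIANT in the sense of HT2 (one odd neighbour, or two linked odd neighbours).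
[cite: KhristoforovSmirnov2021, §2 Lemma 4, proof and Fig. 3 (p. 4)] -/
theorem inv_of_not_relinking {v : HexVertex} {S : Finset (Fin 3)} {ζ : Finset (Sym2 (Site 2))} (hq : IsCoreb D v S ζ)
    (h : ¬ IsRelinking v (S, ζ)) : S.card = 1 ∨ ∃ i ∈ S, ∃ i' ∈ S, i ≠ i' ∧ XiLinked ζ (oppFace v i) (oppFace v i') := by
  classical
  by_cases hS : S = Finset.univ
  · subst hS
    right
    by_contra hne
    apply h
    refine ⟨rfl, fun i i' hii' hl => hne ⟨i, Finset.mem_univ _, i', Finset.mem_univ _, hii', hl⟩⟩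
  · left
    have hle : S.card ≤ 3 := by simpa using Finset.card_le_univ S
    obtain ⟨m, hm⟩ := hq.2.1
    have hne3 : S.card ≠ 3 := fun h3 => hS (Finset.eq_univ_of_card S (by simp only [Fintype.card_fin]; exact h3))
    omega

/-- ★ an INVARIANT core contributes zero to `Σ_i τ^i ObsW` for EVERY class weight (same class and same link relation at the three edges:
`(1 + τ + τ²)·w = 0`). [cite: KhristoforovSmirnov2021, §2 Lemma 4, proof and Fig. 3 (p. 4)] -/
theorem coreTerm_eq_zero_of_not_relinking (wt : Fin nm → Finset (Fin nm × Fin nm) → ℂ) {v : HexVertex} (hv : AllSides D v)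
    {S : Finset (Fin 3)} {ζ : Finset (Sym2 (Site 2))} (hq : IsCoreb D v S ζ) (h : ¬ IsRelinking v (S, ζ)) :
    ∑ i : Fin 3, tau ^ (i : ℕ) * GkW (D := D) wt v i (coreEnd v S i) (coreCompl v S i ζ) = 0 := by
  classical
  have hinv := inv_of_not_relinking hq h
  obtain ⟨j₀, hj₀, -⟩ := hbK_complClass_existsUnique hv hq (0 : Fin 3)
  have hcls := invariantTriplesX_holds D v hv S ζ hq hinv
  have hG : ∀ i : Fin 3, GkW (D := D) wt v i (coreEnd v S i) (coreCompl v S i ζ) = wt j₀ (linkRel D ζ) := fun i => by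
    rw [gkW_compl_eq wt hv hq i ((hcls i 0 j₀).2 hj₀), linkRel_coreCompl_of_inv hv hq hinv i]
  simp only [hG, ← Finset.sum_mul]
  rw [Fin.sum_univ_three]
  simp only [Fin.val_zero, Fin.val_one, Fin.val_two, pow_zero, pow_one]
  linear_combination (wt j₀ (linkRel D ζ)) * tau_sum''

/-- ★ a RE-LINKING core with corner partners `p` contributes exactly the TRIPOD DEFECT of its picture `(p 0, p 1, p 2; linkRel ζ)` — for
EVERY class weight. [cite: KhristoforovSmirnov2021, §2 Lemma 4, proof and Fig. 3 (p. 4)] -/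
theorem coreTerm_eq_tripodDefect (wt : Fin nm → Finset (Fin nm × Fin nm) → ℂ) {v : HexVertex} (hv : AllSides D v)
    {ζ : Finset (Sym2 (Site 2))} (hq : IsCoreb D v Finset.univ ζ)
    (hnl : ∀ i i' : Fin 3, i ≠ i' → ¬ XiLinked ζ (oppFace v i) (oppFace v i'))
    {p : Fin 3 → Fin nm} (hp : ∀ i : Fin 3, XiLinked ζ (oppFace v i) (yc D (p i))) :
    ∑ i : Fin 3, tau ^ (i : ℕ) * GkW (D := D) wt v i (coreEnd v Finset.univ i) (coreCompl v Finset.univ i ζ) =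
      tripodDefect wt (p 0) (p 1) (p 2) (linkRel D ζ) := by
  classical
  have hcls : ∀ i : Fin 3, ComplClassX D v Finset.univ i ζ (p i) := by
    intro i
    unfold ComplClassX
    rw [hbK_inClassX_iff]
    refine ⟨hbK_compl_mem hv i _ ζ hq, ?_⟩
    have hend : coreEnd v Finset.univ i = oppFace v i := by unfold coreEnd; rw [if_pos (Finset.mem_univ i)]
    rw [hend]
    exact (xiLinked_iff_reachable _ _ _).1 (xiLinked_mono (by unfold coreCompl; exact Finset.subset_union_left) (hp i))
  have hG : ∀ i : Fin 3, GkW (D := D) wt v i (coreEnd v Finset.univ i) (coreCompl v Finset.univ i ζ) =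
      wt (p i) (withPair (linkRel D ζ) (p (i + 1)) (p (i + 2))) := fun i => by
    rw [gkW_compl_eq wt hv hq i (hcls i), linkRel_coreCompl_relink hv hq hnl hp i]
  simp only [hG]
  rw [Fin.sum_univ_three]
  simp only [Fin.val_zero, Fin.val_one, Fin.val_two, pow_zero, pow_one, one_mul]
  have e11 : (1 : Fin 3) + 1 = 2 := rfl
  have e12 : (1 : Fin 3) + 2 = 0 := rfl
  have e21 : (2 : Fin 3) + 1 = 0 := rfl
  have e22 : (2 : Fin 3) + 2 = 1 := rfl
  have e01 : (0 : Fin 3) + 1 = 1 := rfl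
  have e02 : (0 : Fin 3) + 2 = 2 := rfl
  rw [e11, e12, e21, e22, e01, e02]
  rfl

end Cores

/-! ### The defect formula -/
section Formula

variable {nm : ℕ} {D : TriMarkedDomain nm}

/-- a **tripod-picture index**: `(α, β, γ, L₀)`. [cite: KhristoforovSmirnov2021, §2 Lemma 4, proof and Fig. 3 (p. 4)] -/
abbrev PicIdx (nm : ℕ) : Type := Fin nm × Fin nm × Fin nm × Finset (Fin nm × Fin nm)

/-- the defect at a picture index. [cite: KhristoforovSmirnov2021, §2 Lemma 4, proof and Fig. 3 (p. 4)] -/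
noncomputable def defectAt (wt : Fin nm → Finset (Fin nm × Fin nm) → ℂ) (P : PicIdx nm) : ℂ :=
  tripodDefect wt P.1 P.2.1 P.2.2.1 P.2.2.2

variable (D) in
/-- the core `q` at `v` is re-linking with PICTURE `P = (α, β, γ, L₀)`: its neighbours `oppFace v 0, 1, 2` are linked to the corners
`y_α, y_β, y_γ` and its link relation among the corners is `L₀`. [cite: KhristoforovSmirnov2021, §2 Lemma 4, proof and Fig. 3 (p. 4)] -/
def HasPicture (v : HexVertex) (q : Finset (Fin 3) × Finset (Sym2 (Site 2))) (P : PicIdx nm) : Prop :=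
  IsRelinking v q ∧ XiLinked q.2 (oppFace v 0) (yc D P.1) ∧ XiLinked q.2 (oppFace v 1) (yc D P.2.1) ∧
    XiLinked q.2 (oppFace v 2) (yc D P.2.2.1) ∧ linkRel D q.2 = P.2.2.2

variable (D) in
open Classical in
/-- **the picture count** `c_P(v)`: the number of re-linking cores at `v` with picture `P`.
[cite: KhristoforovSmirnov2021, §2 Lemma 4, proof and Fig. 3 (p. 4)] -/
noncomputable def pictureCount (v : HexVertex) (P : PicIdx nm) : ℕ := ((coreSetb D v).filter fun q => HasPicture D v q P).card

/-- in a re-linking core the picture is unique. [cite: KhristoforovSmirnov2021, §2 Lemma 4, proof and Fig. 3 (p. 4); §1.2 (p. 2)] -/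
theorem hasPicture_iff_eq {v : HexVertex} (hv : AllSides D v) {ζ : Finset (Sym2 (Site 2))} (hq : IsCoreb D v Finset.univ ζ)
    (hnl : ∀ i i' : Fin 3, i ≠ i' → ¬ XiLinked ζ (oppFace v i) (oppFace v i'))
    {p : Fin 3 → Fin nm} (hp : ∀ i : Fin 3, XiLinked ζ (oppFace v i) (yc D (p i))) (P : PicIdx nm) :
    HasPicture D v (Finset.univ, ζ) P ↔ P = (p 0, p 1, p 2, linkRel D ζ) := by
  constructor
  · rintro ⟨-, h0, h1, h2, hL⟩
    obtain ⟨a, b, c, L⟩ := P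
    simp only at h0 h1 h2 hL
    simp only [Prod.mk.injEq]
    exact ⟨eq_partner_of_linked hv hq hp h0, eq_partner_of_linked hv hq hp h1, eq_partner_of_linked hv hq hp h2, hL.symm⟩
  · rintro rfl
    exact ⟨⟨rfl, hnl⟩, hp 0, hp 1, hp 2, rfl⟩

/-- no picture for a core that is not re-linking. [cite: KhristoforovSmirnov2021, §2 Lemma 4, proof and Fig. 3 (p. 4)] -/
theorem not_hasPicture_of_not_relinking {v : HexVertex} {q : Finset (Fin 3) × Finset (Sym2 (Site 2))} (h : ¬ IsRelinking v q)
    (P : PicIdx nm) : ¬ HasPicture D v q P := fun hP => h hP.1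

open Classical in
/-- the term of one core, as a sum over picture indices. [cite: KhristoforovSmirnov2021, §2 Lemma 4, proof and Fig. 3 (p. 4)] -/
theorem coreTerm_eq_sum_ite (wt : Fin nm → Finset (Fin nm × Fin nm) → ℂ) {v : HexVertex} (hv : AllSides D v)
    {q : Finset (Fin 3) × Finset (Sym2 (Site 2))} (hq : IsCoreb D v q.1 q.2) :
    ∑ i : Fin 3, tau ^ (i : ℕ) * GkW (D := D) wt v i (coreEnd v q.1 i) (coreCompl v q.1 i q.2) =
      ∑ P : PicIdx nm, if HasPicture D v q P then defectAt wt P else 0 := by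
  classical
  obtain ⟨S, ζ⟩ := q
  by_cases h : IsRelinking v (S, ζ)
  · obtain ⟨hS, hnl⟩ := h
    simp only at hS hnl
    subst hS
    choose p hp using hbK_core_partners hv hq hnl
    rw [coreTerm_eq_tripodDefect wt hv hq hnl hp]
    have key : ∀ P : PicIdx nm, (if HasPicture D v (Finset.univ, ζ) P then defectAt wt P else 0) =
        if (p 0, p 1, p 2, linkRel D ζ) = P then defectAt wt P else 0 := by
      intro P
      by_cases hP : (p 0, p 1, p 2, linkRel D ζ) = P
      · rw [if_pos hP, if_pos ((hasPicture_iff_eq hv hq hnl hp P).2 hP.symm)]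
      · rw [if_neg hP, if_neg (fun h => hP ((hasPicture_iff_eq hv hq hnl hp P).1 h).symm)]
    rw [Finset.sum_congr rfl (fun P _ => key P), Finset.sum_ite_eq Finset.univ (p 0, p 1, p 2, linkRel D ζ) (fun P => defectAt wt P),
      if_pos (Finset.mem_univ _)]
    rfl
  · rw [coreTerm_eq_zero_of_not_relinking wt hv hq h]
    symm
    refine Finset.sum_eq_zero fun P _ => ?_
    rw [if_neg (not_hasPicture_of_not_relinking h P)]

/-- ★★ **THE DEFECT FORMULA**: for EVERY class weight, at every face `v` with three `H_G`-sides,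
`Σ_{i : Fin 3} τ^i ObsW D wt v i = Σ_P c_P(v) · tripodDefect wt P` — the holomorphic defect is the picture-count combination of the
tripod defects. [cite: KhristoforovSmirnov2021, §2 Lemma 4, proof and Fig. 3 (p. 4: the grouping in triples; «each triple contributes zero»
is the case of vanishing defects)] -/
theorem sum_tau_obsW_eq_sum_pictureCount (wt : Fin nm → Finset (Fin nm × Fin nm) → ℂ) {v : HexVertex} (hv : AllSides D v) :
    ∑ i : Fin 3, tau ^ (i : ℕ) * ObsW D wt v i = ∑ P : PicIdx nm, (pictureCount D v P : ℂ) * defectAt wt P := by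
  classical
  have step : ∀ i : Fin 3, tau ^ (i : ℕ) * ObsW D wt v i =
      ∑ q ∈ coreSetb D v, tau ^ (i : ℕ) * GkW (D := D) wt v i (coreEnd v q.1 i) (coreCompl v q.1 i q.2) := by
    intro i
    unfold ObsW
    rw [hbK_regroup hv i (fun s ξ => GkW (D := D) wt v i s ξ), Finset.mul_sum]
  simp only [step]
  rw [Finset.sum_comm]
  have hq' : ∀ q ∈ coreSetb D v, IsCoreb D v q.1 q.2 := fun q hq => by
    unfold coreSetb at hq
    exact (Finset.mem_filter.1 hq).2
  rw [Finset.sum_congr rfl fun q hq => coreTerm_eq_sum_ite wt hv (hq' q hq), Finset.sum_comm]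
  refine Finset.sum_congr rfl fun P _ => ?_
  rw [← Finset.sum_filter, Finset.sum_const, nsmul_eq_mul]
  rfl

/-- only TRIPOD PICTURES are counted. [cite: KhristoforovSmirnov2021, §2 Lemma 4, proof and Fig. 3 (p. 4); §1.2 (p. 2)] -/
theorem tripodPicture_of_pictureCount_ne_zero {v : HexVertex} (hv : AllSides D v) {P : PicIdx nm} (h : pictureCount D v P ≠ 0) :
    TripodPicture P.1 P.2.1 P.2.2.1 P.2.2.2 := by
  classical
  unfold pictureCount at h
  obtain ⟨q, hq⟩ := Finset.card_pos.1 (Nat.pos_of_ne_zero h)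
  rw [Finset.mem_filter] at hq
  obtain ⟨hmem, hrel, h0, h1, h2, hL⟩ := hq
  have hcore : IsCoreb D v q.1 q.2 := by
    unfold coreSetb at hmem
    exact (Finset.mem_filter.1 hmem).2
  obtain ⟨S, ζ⟩ := q
  obtain ⟨hS, hnl⟩ := hrel
  simp only at hS hnl hcore h0 h1 h2 hL
  subst hS
  choose p hp using hbK_core_partners hv hcore hnl
  have e0 : P.1 = p 0 := eq_partner_of_linked hv hcore hp h0
  have e1 : P.2.1 = p 1 := eq_partner_of_linked hv hcore hp h1
  have e2 : P.2.2.1 = p 2 := eq_partner_of_linked hv hcore hp h2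
  rw [e0, e1, e2, ← hL]
  exact tripodPicture_of_core hv hcore hnl hp

/-- picture indices that are not tripod pictures have count zero. [cite: KhristoforovSmirnov2021, §2 Lemma 4, proof and Fig. 3 (p. 4)] -/
theorem pictureCount_eq_zero_of_not_tripodPicture {v : HexVertex} (hv : AllSides D v) {P : PicIdx nm}
    (h : ¬ TripodPicture P.1 P.2.1 P.2.2.1 P.2.2.2) : pictureCount D v P = 0 := by
  by_contra hne
  exact h (tripodPicture_of_pictureCount_ne_zero hv hne)

/-- ★ **weights with equal defects on tripod pictures have equal holomorphic defects** at every face of every domain.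
[cite: KhristoforovSmirnov2021, §2 Lemma 4, proof and Fig. 3 (p. 4)] -/
theorem sum_tau_obsW_eq_of_tripodDefect_eq {wt wt' : Fin nm → Finset (Fin nm × Fin nm) → ℂ}
    (h : ∀ (α β γ : Fin nm) (L₀ : Finset (Fin nm × Fin nm)), TripodPicture α β γ L₀ →
      tripodDefect wt α β γ L₀ = tripodDefect wt' α β γ L₀) {v : HexVertex} (hv : AllSides D v) :
    ∑ i : Fin 3, tau ^ (i : ℕ) * ObsW D wt v i = ∑ i : Fin 3, tau ^ (i : ℕ) * ObsW D wt' v i := by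
  rw [sum_tau_obsW_eq_sum_pictureCount wt hv, sum_tau_obsW_eq_sum_pictureCount wt' hv]
  refine Finset.sum_congr rfl fun P _ => ?_
  by_cases hP : TripodPicture P.1 P.2.1 P.2.2.1 P.2.2.2
  · unfold defectAt
    rw [h _ _ _ _ hP]
  · rw [pictureCount_eq_zero_of_not_tripodPicture hv hP, Nat.cast_zero, zero_mul, zero_mul]

/-- **holomorphicity as a finite linear system in the defects**: `wt` is discretely holomorphic on `D` iff
`Σ_P c_P(v) · tripodDefect wt P = 0` at every face `v` of `D` with three `H_G`-sides.
[cite: KhristoforovSmirnov2021, §2 Lemma 4 eq. (3) (p. 4)] -/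
theorem holomorphicW_iff_sum_pictureCount (D : TriMarkedDomain nm) (wt : Fin nm → Finset (Fin nm × Fin nm) → ℂ) :
    HolomorphicW D wt ↔ ∀ v : HexVertex, AllSides D v → ∑ P : PicIdx nm, (pictureCount D v P : ℂ) * defectAt wt P = 0 := by
  unfold HolomorphicW
  exact forall_congr' fun v => forall_congr' fun hv => by rw [sum_tau_obsW_eq_sum_pictureCount wt hv]

/-- HOLO-K's theorem as the case of vanishing defects (a second proof of `holomorphicW_of_tripodLaw`).
[cite: KhristoforovSmirnov2021, §2 Lemma 4 (p. 4) with its proof and Fig. 3] -/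
theorem holomorphicW_of_tripodLaw' (D : TriMarkedDomain nm) {wt : Fin nm → Finset (Fin nm × Fin nm) → ℂ} (hR : TripodLaw wt) :
    HolomorphicW D wt := by
  rw [holomorphicW_iff_sum_pictureCount]
  intro v hv
  refine Finset.sum_eq_zero fun P _ => ?_
  by_cases hP : TripodPicture P.1 P.2.1 P.2.2.1 P.2.2.2
  · unfold defectAt
    rw [(tripodLaw_iff_tripodDefect wt).1 hR _ _ _ _ hP, mul_zero]
  · rw [pictureCount_eq_zero_of_not_tripodPicture hv hP, Nat.cast_zero, zero_mul]

end Formula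

/-! ### Three disorders: the closed form -/
section Three

variable {D : TriMarkedDomain 3}

/-- at `k = 3` a tripod picture is a rotation of `(0, 1, 2)` with EMPTY relation (no other corners).
[cite: KhristoforovSmirnov2021, §2 Lemma 4, proof and Fig. 3 (p. 4: three disorders, `u₁, u₂, u₃` counterclockwise)] -/
theorem tripodPicture_three {α β γ : Fin 3} {L₀ : Finset (Fin 3 × Fin 3)} (h : TripodPicture α β γ L₀) :
    β = α + 1 ∧ γ = α + 2 ∧ L₀ = ∅ := by
  have key : ∀ a b c : Fin 3, CcwTriple a b c → b = a + 1 ∧ c = a + 2 := by unfold CcwTriple; decide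
  obtain ⟨hβ, hγ⟩ := key α β γ h.ccw
  refine ⟨hβ, hγ, Finset.eq_empty_of_forall_notMem fun ab hab => ?_⟩
  obtain ⟨a, b⟩ := ab
  obtain ⟨ha, hb, hc⟩ := h.off a b hab
  have hall : ∀ a d : Fin 3, a ≠ d → a ≠ d + 1 → a ≠ d + 2 → False := by decide
  exact hall a α ha (hβ ▸ hb) (hγ ▸ hc)

/-- at `k = 3` the defect of the reading starting at corner `d` is `τ^{2d}` times the defect `Δ(wt) = wt 0 (12) + τ·wt 1 (20) + τ²·wt 2 (01)`
of the reading `(0, 1, 2)`. [cite: KhristoforovSmirnov2021, §2 Lemma 4, proof and Fig. 3 (p. 4)] -/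
theorem tripodDefect_three (wt : Fin 3 → Finset (Fin 3 × Fin 3) → ℂ) (d : Fin 3) :
    tripodDefect wt d (d + 1) (d + 2) ∅ = tau ^ (2 * (d : ℕ)) * tripodDefect wt 0 1 2 ∅ := by
  have h3 : ∀ d : Fin 3, d = 0 ∨ d = 1 ∨ d = 2 := by decide
  rcases h3 d with rfl | rfl | rfl
  · have e1 : (0 : Fin 3) + 1 = 1 := rfl
    have e2 : (0 : Fin 3) + 2 = 2 := rfl
    rw [e1, e2, Fin.val_zero, mul_zero, pow_zero, one_mul]
  · have e1 : (1 : Fin 3) + 1 = 2 := rfl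
    have e2 : (1 : Fin 3) + 2 = 0 := rfl
    rw [e1, e2, Fin.val_one, mul_one, tripodDefect_rotate]
  · have e1 : (2 : Fin 3) + 1 = 0 := rfl
    have e2 : (2 : Fin 3) + 2 = 1 := rfl
    rw [e1, e2, Fin.val_two, tripodDefect_rotate, tripodDefect_rotate]
    ring

variable (D) in
/-- **the RE-LINKING INDEX** `N_D(v) ∈ ℤ[τ]` of a face of a three-marked domain: `Σ_d τ^{2d} · #{re-linking cores at v whose neighbour
`oppFace v 0` is linked to the corner `y_d}` — the domain-dependent coefficient of the three-disorder defect formula.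
[cite: KhristoforovSmirnov2021, §2 Lemma 4, proof and Fig. 3 (p. 4: the re-linking triples at a vertex)] -/
noncomputable def relinkIndex (v : HexVertex) : ℂ := ∑ P : PicIdx 3, (pictureCount D v P : ℂ) * tau ^ (2 * (P.1 : ℕ))

/-- ★★ **THREE DISORDERS, CLOSED FORM**: for EVERY class weight on a three-marked domain,
`Σ_{i : Fin 3} τ^i ObsW D wt v i = N_D(v) · Δ(wt)` with `Δ(wt) = wt 0 (12) + τ·wt 1 (20) + τ²·wt 2 (01)` — the contour sum of
Khristoforov–Smirnov's Lemma 4 for arbitrary weights is the re-linking index times ONE number. (Their weight `τ^j` has `Δ = 1 + τ² + τ⁴ = 0`: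
Lemma 4.) [cite: KhristoforovSmirnov2021, §2 Lemma 4 (p. 4) with its proof and Fig. 3] -/
theorem sum_tau_obsW_three (wt : Fin 3 → Finset (Fin 3 × Fin 3) → ℂ) {v : HexVertex} (hv : AllSides D v) :
    ∑ i : Fin 3, tau ^ (i : ℕ) * ObsW D wt v i = relinkIndex D v * tripodDefect wt 0 1 2 ∅ := by
  rw [sum_tau_obsW_eq_sum_pictureCount wt hv]
  unfold relinkIndex
  rw [Finset.sum_mul]
  refine Finset.sum_congr rfl ?_
  rintro ⟨a, b, c, L⟩ -
  by_cases hP : TripodPicture a b c L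
  · obtain ⟨hb, hc, hL⟩ := tripodPicture_three hP
    subst hb hc hL
    show (pictureCount D v (a, a + 1, a + 2, ∅) : ℂ) * tripodDefect wt a (a + 1) (a + 2) ∅ = _
    rw [tripodDefect_three, mul_assoc]
  · rw [pictureCount_eq_zero_of_not_tripodPicture hv (P := (a, b, c, L)) hP, Nat.cast_zero, zero_mul, zero_mul, zero_mul]

/-- ★ **holomorphicity at three disorders**: a class weight is discretely holomorphic on `D` iff EITHER it obeys Khristoforov–Smirnov's relation
`wt 0 (12) + τ·wt 1 (20) + τ²·wt 2 (01) = 0` OR the re-linking index of `D` vanishes at every all-sides face.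
[cite: KhristoforovSmirnov2021, §2 Lemma 4 eq. (3) (p. 4)] -/
theorem holomorphicW_three_iff (D : TriMarkedDomain 3) (wt : Fin 3 → Finset (Fin 3 × Fin 3) → ℂ) :
    HolomorphicW D wt ↔ tripodDefect wt 0 1 2 ∅ = 0 ∨ ∀ v : HexVertex, AllSides D v → relinkIndex D v = 0 := by
  unfold HolomorphicW
  constructor
  · intro h
    by_cases hΔ : tripodDefect wt 0 1 2 ∅ = 0
    · exact Or.inl hΔ
    · refine Or.inr fun v hv => ?_
      have := h v hv
      rw [sum_tau_obsW_three wt hv] at this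
      exact (mul_eq_zero.1 this).resolve_right hΔ
  · intro h v hv
    rw [sum_tau_obsW_three wt hv]
    rcases h with h | h
    · rw [h, mul_zero]
    · rw [h v hv, zero_mul]

/-- ★ **what the re-linking index IS**: one third of the contour sum of the CONJUGATE weight `j ↦ τ^{2j} = τ̄^j` (its `Δ` is
`1 + τ³ + τ⁶ = 3`) — so `N_D(v)` is itself an observable quantity of the three-disorder loop ensemble.
[cite: KhristoforovSmirnov2021, §2 Definition 3 and Lemma 4 (p. 4)] -/
theorem sum_tau_obsW_conj_three {v : HexVertex} (hv : AllSides D v) :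
    ∑ i : Fin 3, tau ^ (i : ℕ) * ObsW D (fun (j : Fin 3) (_ : Finset (Fin 3 × Fin 3)) => tau ^ (2 * (j : ℕ))) v i = 3 * relinkIndex D v := by
  rw [sum_tau_obsW_three _ hv]
  unfold tripodDefect
  simp only [Fin.val_zero, Fin.val_one, Fin.val_two]
  linear_combination (relinkIndex D v * (tau ^ 3 + 2)) * tau_cube''

end Three

end Literature.Probability.Percolation.MarkedLoops
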